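import Mathlib
import Summits.NavierStokesRegularity.NavierStokesRegularity.Theorems.L3TimeExponentPincerQuantJawEnergyLine
import Summits.NavierStokesRegularity.NavierStokesRegularity.Theorems.L3TimeExponentPincerCritModulus
import HarnessLib.Audit
import HarnessLib

/-!
# L3TimeExponentPincer — the energy line is rigid in `L⁶` and in `L^∞`:
# `QuantBound 6 q ↔ q ≤ 2`, and `¬ QuantBound ∞ q` for every `q > 4/3`

Support kernel for the crux `L3CascadeJaw` (item stmt-NavierStokesRegularity-19499); sequel of
`…QuantJawEnergyLine` (`QuantJaw q ↔ q ≤ 4`, i.e. the case `p = 3`).  ROUND-11's remark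
«the energy line is rigid in every mixed norm» (`not_quantBound_above_energyLine`, conditional
on an `L^p` persistence family) is made UNCONDITIONAL at `p = 6` and `p = ∞` with no new fluid
analysis: the `L³` ring family (`lpPersistence_three_half_two`) and the energy bound
`∫|u(t)|² ≤ 1` give, by interpolation,

* `‖u(t)‖_∞ ≥ ‖u(t)‖₃³` (`∫|u|³ ≤ ‖u‖_∞∫|u|²`, `…CritModulus.eLpNorm_three_rpow_le_of_top_two`)
  ⇒ `lpPersistence_top : LpPersistence ∞ (3/2) 2` ⇒ `not_quantBound_top : 4/3 < q → ¬ QuantBound ∞ q`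
  (no `(E₀, ν, T)`-uniform bound on `∫₀ᵀ‖u‖_∞^q` above the energy line `q = 4/3`);
* `‖u(t)‖₆ ≥ ‖u(t)‖₃²` (`∫|u|³ ≤ (∫|u|²)^{3/4}(∫|u|⁶)^{1/4}`, `lintegral_pow_three_le_Lp_interpolation`)
  ⇒ `lpPersistence_six : LpPersistence 6 1 2` ⇒ `not_quantBound_six : 2 < q → ¬ QuantBound 6 q`;
* ON the line at `p = 6` (`q = 2`, `L²_t L⁶_x = L²_t Ḣ¹_x`): `lpTime_six_two_le`
  (`∫₀ᵀ‖u‖₆² ≤ K² E(u₀)/ν`, Gagliardo–Nirenberg–Sobolev + the dissipation bound of the energy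
  inequality, as in `lpTime_three_four_le`), `quantBound_six_two`, `quantBound_six_of_le_two`, and
  the dichotomy `quantBound_six_iff : 0 ≤ q → (QuantBound 6 q ↔ q ≤ 2)`.

WHAT THIS IS NOT: not NS regularity or blow-up; statements about (E₀, ν, T)-UNIFORM constants over
Schwartz data (viscous rings vs energy × dissipation); the crux `L3CascadeJaw` is untouched;
no crux claim.
-/

noncomputable section

namespace Summit.NavierStokesRegularity.NavierStokesRegularity.Theorems.L3TimeExponentPincerEnergyLineSixTop

open MeasureTheory Set Filter Literature.Analysis.FluidPDE
open Summit.NavierStokesRegularity.NavierStokesRegularity.Theorems.L3TimeExponentPincerQuantJaw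
open Summit.NavierStokesRegularity.NavierStokesRegularity.Theorems.L3TimeExponentPincerJawEnergyFloor
open Summit.NavierStokesRegularity.NavierStokesRegularity.Theorems.L3TimeExponentPincerCritModulus
open Summit.NavierStokesRegularity.NavierStokesRegularity.Theorems.L3TimeExponentPincerRingPersistenceHolds
open Summit.NavierStokesRegularity.NavierStokesRegularity.Theorems.L3TimeExponentPincerQuantJawEnergyLine
open scoped ENNReal NNReal

/-! ### A. `p = ∞`: the rings give `LpPersistence ∞ (3/2) 2` -/

/-- **`L^∞` persistence of the ring family**: `‖u(t)‖_∞ ≥ c³ ℓ^{-3/2}` on `(0, c³ℓ²)` — from the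
`L³` floor `c ℓ^{-1/2}` by `‖u‖₃³ ≤ ‖u‖_∞ ∫|u|² ≤ ‖u‖_∞`. -/
theorem lpPersistence_top : LpPersistence ∞ (3 / 2) 2 := by
  obtain ⟨c, hc, hc1, hfam⟩ := lpPersistence_three_half_two
  have hc3 : c ^ 3 ≤ c := by
    calc c ^ 3 ≤ c ^ 1 := pow_le_pow_of_le_one hc.le hc1 (by norm_num)
      _ = c := pow_one c
  refine ⟨c ^ 3, by positivity, hc3.trans hc1, fun ℓ hℓ hℓ1 => ?_⟩
  obtain ⟨u, pr, hF, hE, hfloor⟩ := hfam ℓ hℓ hℓ1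
  refine ⟨u, pr, hF, hE, fun t ht => ?_⟩
  have hℓ2 : 0 < ℓ ^ (2 : ℝ) := Real.rpow_pos_of_pos hℓ _
  have ht' : t ∈ Ioo 0 (c * ℓ ^ (2 : ℝ)) :=
    ⟨ht.1, ht.2.trans_le (mul_le_mul_of_nonneg_right hc3 hℓ2.le)⟩
  have hwin1 : c * ℓ ^ (2 : ℝ) ≤ 1 := by
    calc c * ℓ ^ (2 : ℝ) ≤ 1 * 1 :=
          mul_le_mul hc1 (Real.rpow_le_one hℓ.le hℓ1 (by norm_num)) hℓ2.le zero_le_one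
      _ = 1 := one_mul _
  have ht1 : t < 1 := ht'.2.trans_le hwin1
  have hfl := hfloor t ht'
  have hen : ∫⁻ x, ‖u t x‖ₑ ^ 2 ≤ 1 :=
    (frame_lintegral_sq_le_energy0 zero_le_one hF ⟨ht.1.le, ht1.le⟩).trans hE
  have hint := eLpNorm_three_rpow_le_of_top_two (μ := volume)
    (frame_aestronglyMeasurable hF ⟨ht.1, ht1⟩) (q := 3) (by norm_num)
  rw [show (3 : ℝ) / 3 = 1 by norm_num, ENNReal.rpow_one, ENNReal.rpow_one,
    show (3 : ℝ) = ((3 : ℕ) : ℝ) by norm_num, ENNReal.rpow_natCast] at hint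
  have hx0 : 0 ≤ c * ℓ ^ (-(1 / 2 : ℝ)) := by positivity
  have e : c ^ 3 * ℓ ^ (-(3 / 2 : ℝ)) = (c * ℓ ^ (-(1 / 2 : ℝ))) ^ 3 := by
    rw [mul_pow, ← Real.rpow_natCast (ℓ ^ (-(1 / 2 : ℝ))) 3, ← Real.rpow_mul hℓ.le]
    norm_num
  calc ENNReal.ofReal (c ^ 3 * ℓ ^ (-(3 / 2 : ℝ)))
      = ENNReal.ofReal (c * ℓ ^ (-(1 / 2 : ℝ))) ^ 3 := by rw [e, ENNReal.ofReal_pow hx0]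
    _ ≤ eLpNorm (u t) 3 volume ^ 3 := by gcongr
    _ ≤ eLpNorm (u t) ⊤ volume * ∫⁻ x, ‖u t x‖ₑ ^ 2 := hint
    _ ≤ eLpNorm (u t) ⊤ volume * 1 := by gcongr
    _ = eLpNorm (u t) ⊤ volume := mul_one _

/-- **No uniform `L^q_t L^∞_x` bound above the energy line**: `¬ QuantBound ∞ q` for every
`q > 4/3`. -/
theorem not_quantBound_top {q : ℝ} (hq : 4 / 3 < q) : ¬ QuantBound ∞ q :=
  not_quantBound_of_persistence (by norm_num) (by linarith) lpPersistence_top (by linarith)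

/-! ### B. `p = 6`: the rings give `LpPersistence 6 1 2` -/

/-- **`L⁶` persistence of the ring family**: `‖u(t)‖₆ ≥ c² ℓ^{-1}` on `(0, c²ℓ²)` — from the `L³`
floor by `∫|u|³ ≤ (∫|u|²)^{3/4} (∫|u|⁶)^{1/4}` and `∫|u(t)|² ≤ 1`, i.e. `‖u‖₃² ≤ ‖u‖₆`. -/
theorem lpPersistence_six : LpPersistence 6 1 2 := by
  obtain ⟨c, hc, hc1, hfam⟩ := lpPersistence_three_half_two
  have hc2 : c ^ 2 ≤ c := by
    calc c ^ 2 ≤ c ^ 1 := pow_le_pow_of_le_one hc.le hc1 (by norm_num)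
      _ = c := pow_one c
  refine ⟨c ^ 2, by positivity, hc2.trans hc1, fun ℓ hℓ hℓ1 => ?_⟩
  obtain ⟨u, pr, hF, hE, hfloor⟩ := hfam ℓ hℓ hℓ1
  refine ⟨u, pr, hF, hE, fun t ht => ?_⟩
  have hℓ2 : 0 < ℓ ^ (2 : ℝ) := Real.rpow_pos_of_pos hℓ _
  have ht' : t ∈ Ioo 0 (c * ℓ ^ (2 : ℝ)) :=
    ⟨ht.1, ht.2.trans_le (mul_le_mul_of_nonneg_right hc2 hℓ2.le)⟩
  have hwin1 : c * ℓ ^ (2 : ℝ) ≤ 1 := by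
    calc c * ℓ ^ (2 : ℝ) ≤ 1 * 1 :=
          mul_le_mul hc1 (Real.rpow_le_one hℓ.le hℓ1 (by norm_num)) hℓ2.le zero_le_one
      _ = 1 := one_mul _
  have ht1 : t < 1 := ht'.2.trans_le hwin1
  have hfl := hfloor t ht'
  have hen : ∫⁻ x, ‖u t x‖ₑ ^ 2 ≤ 1 :=
    (frame_lintegral_sq_le_energy0 zero_le_one hF ⟨ht.1.le, ht1.le⟩).trans hE
  have hmeas : AEMeasurable (fun x => ‖u t x‖ₑ) volume :=
    (frame_aestronglyMeasurable hF ⟨ht.1, ht1⟩).enorm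
  have hI := lintegral_pow_three_le_Lp_interpolation volume hmeas
  -- `‖u‖₃³ = ∫|u|³`, `∫|u|⁶ = ‖u‖₆⁶`
  have e3 : eLpNorm (u t) 3 volume ^ (3 : ℕ) = ∫⁻ x, ‖u t x‖ₑ ^ (3 : ℕ) := by
    have h := eLpNorm_rpow_eq_lintegral volume (u t) (p := 3) (by norm_num)
    rw [show ENNReal.ofReal (3 : ℝ) = 3 by norm_num] at h
    rw [← ENNReal.rpow_natCast, show ((3 : ℕ) : ℝ) = 3 by norm_num, h]
    refine lintegral_congr fun x => ?_
    rw [show (3 : ℝ) = ((3 : ℕ) : ℝ) by norm_num, ENNReal.rpow_natCast]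
  have e6 : (∫⁻ x, ‖u t x‖ₑ ^ (6 : ℝ)) = eLpNorm (u t) 6 volume ^ (6 : ℝ) := by
    have h := eLpNorm_rpow_eq_lintegral volume (u t) (p := 6) (by norm_num)
    rw [show ENNReal.ofReal (6 : ℝ) = 6 by norm_num] at h
    exact h.symm
  have hkey : eLpNorm (u t) 3 volume ^ (3 : ℕ) ≤ eLpNorm (u t) 6 volume ^ (3 / 2 : ℝ) := by
    calc eLpNorm (u t) 3 volume ^ (3 : ℕ) = ∫⁻ x, ‖u t x‖ₑ ^ (3 : ℕ) := e3
      _ ≤ (∫⁻ x, ‖u t x‖ₑ ^ (2 : ℕ)) ^ (3 / 4 : ℝ) * (∫⁻ x, ‖u t x‖ₑ ^ (6 : ℝ)) ^ (1 / 4 : ℝ) := hI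
      _ ≤ (1 : ℝ≥0∞) ^ (3 / 4 : ℝ) * (∫⁻ x, ‖u t x‖ₑ ^ (6 : ℝ)) ^ (1 / 4 : ℝ) := by gcongr
      _ = eLpNorm (u t) 6 volume ^ (3 / 2 : ℝ) := by
          rw [ENNReal.one_rpow, one_mul, e6, ← ENNReal.rpow_mul]; norm_num
  have hkey2 : eLpNorm (u t) 3 volume ^ (2 : ℕ) ≤ eLpNorm (u t) 6 volume := by
    have h := ENNReal.rpow_le_rpow hkey (by norm_num : (0 : ℝ) ≤ 2 / 3)
    rwa [← ENNReal.rpow_natCast, ← ENNReal.rpow_mul, ← ENNReal.rpow_mul,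
      show ((3 : ℕ) : ℝ) * (2 / 3) = ((2 : ℕ) : ℝ) by norm_num,
      show (3 / 2 : ℝ) * (2 / 3) = 1 by norm_num, ENNReal.rpow_natCast, ENNReal.rpow_one] at h
  have hx0 : 0 ≤ c * ℓ ^ (-(1 / 2 : ℝ)) := by positivity
  have e : c ^ 2 * ℓ ^ (-(1 : ℝ)) = (c * ℓ ^ (-(1 / 2 : ℝ))) ^ 2 := by
    rw [mul_pow, ← Real.rpow_natCast (ℓ ^ (-(1 / 2 : ℝ))) 2, ← Real.rpow_mul hℓ.le]
    norm_num
  calc ENNReal.ofReal (c ^ 2 * ℓ ^ (-(1 : ℝ)))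
      = ENNReal.ofReal (c * ℓ ^ (-(1 / 2 : ℝ))) ^ 2 := by rw [e, ENNReal.ofReal_pow hx0]
    _ ≤ eLpNorm (u t) 3 volume ^ 2 := by gcongr
    _ ≤ eLpNorm (u t) 6 volume := hkey2

/-- **No uniform `L^q_t L⁶_x` bound above the energy line**: `¬ QuantBound 6 q` for every `q > 2`. -/
theorem not_quantBound_six {q : ℝ} (hq : 2 < q) : ¬ QuantBound 6 q :=
  not_quantBound_of_persistence (by norm_num) (by linarith) lpPersistence_six (by linarith)

/-! ### C. `p = 6` ON the line: `QuantBound 6 2` by Sobolev × dissipation, and the dichotomy -/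

/-- Slice inequality `‖w‖₆² ≤ K² ∫|∇w|²` for a `C¹` field `w ∈ L²` (Gagliardo–Nirenberg–Sobolev,
`eLpNorm_six_le_eLpNorm_fderiv_two`, operator norm `≤` Frobenius norm). -/
theorem eLpNorm_six_rpow_two_le {w : EuclideanSpace ℝ (Fin 3) → EuclideanSpace ℝ (Fin 3)}
    (hw : ContDiff ℝ 1 w) (h2 : ∫⁻ x, ‖w x‖ₑ ^ 2 < ⊤) :
    eLpNorm w 6 volume ^ (2 : ℝ) ≤
      ((SNormLESNormFDerivOfEqConst (EuclideanSpace ℝ (Fin 3))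
          (volume : Measure (EuclideanSpace ℝ (Fin 3))) 2 : ℝ≥0) : ℝ≥0∞) ^ 2 *
        ∫⁻ x, ENNReal.ofReal (frobeniusNormSq (fderiv ℝ w x)) := by
  have h2' : eLpNorm w 2 volume < ⊤ := by
    rw [eLpNorm_lt_top_iff_lintegral_rpow_enorm_lt_top (by norm_num) (by norm_num),
      ENNReal.toReal_ofNat]
    have e : ∫⁻ x, ‖w x‖ₑ ^ (2 : ℝ) = ∫⁻ x, ‖w x‖ₑ ^ 2 :=
      lintegral_congr fun x => by rw [show (2 : ℝ) = ((2 : ℕ) : ℝ) by norm_num, ENNReal.rpow_natCast]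
    rw [e]
    exact h2
  have hS := eLpNorm_six_le_eLpNorm_fderiv_two volume finrank_euclideanSpace_fin hw h2'
  have hD' : eLpNorm (fderiv ℝ w) 2 volume ^ 2 ≤
      ∫⁻ x, ENNReal.ofReal (frobeniusNormSq (fderiv ℝ w x)) := by
    rw [← lintegral_enorm_sq_eq_eLpNorm_two_pow]
    refine lintegral_mono fun x => ?_
    rw [← ofReal_norm, ← ENNReal.ofReal_pow (norm_nonneg _)]
    exact ENNReal.ofReal_le_ofReal (sq_opNorm_le_frobeniusNormSq _)
  have e2 : eLpNorm w 6 volume ^ (2 : ℝ) = eLpNorm w 6 volume ^ (2 : ℕ) := by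
    rw [← ENNReal.rpow_natCast]; norm_num
  rw [e2]
  calc eLpNorm w 6 volume ^ 2
      ≤ (((SNormLESNormFDerivOfEqConst (EuclideanSpace ℝ (Fin 3))
          (volume : Measure (EuclideanSpace ℝ (Fin 3))) 2 : ℝ≥0) : ℝ≥0∞) *
          eLpNorm (fderiv ℝ w) 2 volume) ^ 2 := pow_le_pow_left' hS 2
    _ = ((SNormLESNormFDerivOfEqConst (EuclideanSpace ℝ (Fin 3))
          (volume : Measure (EuclideanSpace ℝ (Fin 3))) 2 : ℝ≥0) : ℝ≥0∞) ^ 2 *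
          eLpNorm (fderiv ℝ w) 2 volume ^ 2 := by rw [mul_pow]
    _ ≤ _ := by gcongr

/-- **`∫₀ᵀ ‖u‖₆² ≤ K² · E(u₀)/ν`** for every frame solution (`ν, T > 0`). -/
theorem lpTime_six_two_le {ν T : ℝ} (hν : 0 < ν) (hT : 0 < T) {u : ℝ → E3 → E3}
    {pr : ℝ → E3 → ℝ} (hF : IsFrameSolution ν T u pr) :
    lpTime 6 2 T u ≤
      ((SNormLESNormFDerivOfEqConst (EuclideanSpace ℝ (Fin 3))
          (volume : Measure (EuclideanSpace ℝ (Fin 3))) 2 : ℝ≥0) : ℝ≥0∞) ^ 2 *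
        ENNReal.ofReal (VectorCalculus.kineticEnergy (u 0) / ν) := by
  set K : ℝ≥0 := SNormLESNormFDerivOfEqConst (EuclideanSpace ℝ (Fin 3))
    (volume : Measure (EuclideanSpace ℝ (Fin 3))) 2 with hK
  have hcl := hF.classical
  have hLH := hF.lerayHopf
  have hE0eq : energy0 u = ENNReal.ofReal (2 * VectorCalculus.kineticEnergy (u 0)) := by
    have := hLH.eEnergy_eq (t := 0) ⟨le_rfl, hT.le⟩
    rwa [eEnergy] at this
  have hen : ∀ t ∈ Ioo 0 T, ∫⁻ x, ‖u t x‖ₑ ^ 2 ≤ energy0 u := by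
    intro t ht
    rw [hE0eq]
    exact hLH.lintegral_enorm_sq_le hν.le ⟨ht.1.le, ht.2.le⟩
  have hE0fin : energy0 u < ⊤ := energy0_lt_top_of_hasRapidSpatialDecay hF.decay
  obtain ⟨m, G, -, hG, hD⟩ := hLH.exists_measurable_dissipation hν hT
  have hslice : ∀ᵐ t ∂(volume.restrict (Ioo 0 T)),
      eLpNorm (u t) 6 volume ^ (2 : ℝ) ≤ (K : ℝ≥0∞) ^ 2 * m t := by
    filter_upwards [hG, ae_restrict_mem measurableSet_Ioo] with t hGt ht
    obtain ⟨hwG, hmt, -⟩ := hGt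
    have htc : t ∈ Ico 0 T := ⟨ht.1.le, ht.2⟩
    have hC1 : ContDiff ℝ 1 (u t) := (hcl.contDiff_velocity htc).of_le (by norm_cast)
    have hwF : HasWeakGradient (u t) (fderiv ℝ (u t)) := hasWeakGradient_fderiv_of_contDiff hC1
    have heq : (fun x => fderiv ℝ (u t) x) =ᵐ[volume] G t := by
      have := Literature.Analysis.FunctionSpaces.HasWeakFDerivOn.unique_holds hwF hwG
      simpa [Measure.restrict_univ] using this
    have hdiss : ∫⁻ x, ENNReal.ofReal (frobeniusNormSq (fderiv ℝ (u t) x)) = m t := by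
      rw [← hmt]
      refine lintegral_congr_ae ?_
      filter_upwards [heq] with x hx
      rw [hx]
    have h1 := eLpNorm_six_rpow_two_le hC1 ((hen t ht).trans_lt hE0fin)
    rwa [hdiss] at h1
  have hcst : (K : ℝ≥0∞) ^ 2 ≠ ⊤ := ENNReal.pow_ne_top ENNReal.coe_ne_top
  calc lpTime 6 2 T u = ∫⁻ t in Ioo 0 T, eLpNorm (u t) 6 volume ^ (2 : ℝ) := rfl
    _ ≤ ∫⁻ t in Ioo 0 T, (K : ℝ≥0∞) ^ 2 * m t := lintegral_mono_ae hslice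
    _ = (K : ℝ≥0∞) ^ 2 * ∫⁻ t in Ioo 0 T, m t := lintegral_const_mul' _ _ hcst
    _ ≤ (K : ℝ≥0∞) ^ 2 * ENNReal.ofReal (VectorCalculus.kineticEnergy (u 0) / ν) :=
        mul_le_mul' le_rfl hD

/-- **`QuantBound 6 2`: the uniform `L²_t L⁶_x` bound ON the energy line** (constant `K² E/(2ν)`). -/
theorem quantBound_six_two : QuantBound 6 2 := by
  intro ν T E hν hT hE
  set K : ℝ≥0 := SNormLESNormFDerivOfEqConst (EuclideanSpace ℝ (Fin 3))
    (volume : Measure (EuclideanSpace ℝ (Fin 3))) 2 with hK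
  set B : ℝ≥0∞ := (K : ℝ≥0∞) ^ 2 * ENNReal.ofReal (E / (2 * ν)) with hB
  have hBt : B ≠ ⊤ := ENNReal.mul_ne_top (ENNReal.pow_ne_top ENNReal.coe_ne_top) ENNReal.ofReal_ne_top
  refine ⟨B.toNNReal, fun u pr hF hEu => ?_⟩
  rw [ENNReal.coe_toNNReal hBt]
  have hE0eq : energy0 u = ENNReal.ofReal (2 * VectorCalculus.kineticEnergy (u 0)) := by
    have := hF.lerayHopf.eEnergy_eq (t := 0) ⟨le_rfl, hT.le⟩
    rwa [eEnergy] at this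
  have hkin : VectorCalculus.kineticEnergy (u 0) / ν ≤ E / (2 * ν) := by
    have h2 : 2 * VectorCalculus.kineticEnergy (u 0) ≤ E := by
      rw [hE0eq] at hEu
      exact (ENNReal.ofReal_le_ofReal_iff hE).1 hEu
    rw [div_le_div_iff₀ hν (by positivity)]
    nlinarith
  calc lpTime 6 2 T u ≤ (K : ℝ≥0∞) ^ 2 * ENNReal.ofReal (VectorCalculus.kineticEnergy (u 0) / ν) :=
        lpTime_six_two_le hν hT hF
    _ ≤ (K : ℝ≥0∞) ^ 2 * ENNReal.ofReal (E / (2 * ν)) := by gcongr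
    _ = B := rfl

/-- `x^q ≤ 1 + x²` in `ℝ≥0∞` for `0 ≤ q ≤ 2`. -/
theorem rpow_le_one_add_rpow_two {x : ℝ≥0∞} {q : ℝ} (hq0 : 0 ≤ q) (hq2 : q ≤ 2) :
    x ^ q ≤ 1 + x ^ (2 : ℝ) := by
  rcases le_total x 1 with h | h
  · exact (ENNReal.rpow_le_one h hq0).trans le_self_add
  · exact (ENNReal.rpow_le_rpow_of_exponent_le h hq2).trans le_add_self

/-- **`QuantBound 6 q` for every `0 ≤ q ≤ 2`** (`∫₀ᵀ‖u‖₆^q ≤ T + ∫₀ᵀ‖u‖₆²`). -/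
theorem quantBound_six_of_le_two {q : ℝ} (hq0 : 0 ≤ q) (hq2 : q ≤ 2) : QuantBound 6 q := by
  intro ν T E hν hT hE
  obtain ⟨B, hB⟩ := quantBound_six_two ν T E hν hT hE
  refine ⟨(ENNReal.ofReal T).toNNReal + B, fun u pr hF hEu => ?_⟩
  have h2 := hB u pr hF hEu
  calc lpTime 6 q T u = ∫⁻ t in Ioo 0 T, eLpNorm (u t) 6 volume ^ q := rfl
    _ ≤ ∫⁻ t in Ioo 0 T, ((fun _ => (1 : ℝ≥0∞)) t + eLpNorm (u t) 6 volume ^ (2 : ℝ)) :=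
        lintegral_mono fun t => rpow_le_one_add_rpow_two hq0 hq2
    _ = (∫⁻ _ in Ioo 0 T, (1 : ℝ≥0∞)) + ∫⁻ t in Ioo 0 T, eLpNorm (u t) 6 volume ^ (2 : ℝ) :=
        lintegral_add_left measurable_const _
    _ ≤ ENNReal.ofReal T + (B : ℝ≥0∞) := by
        gcongr
        · rw [setLIntegral_const, Real.volume_Ioo, sub_zero, one_mul]
        · exact h2
    _ = (((ENNReal.ofReal T).toNNReal + B : ℝ≥0) : ℝ≥0∞) := by
        rw [ENNReal.coe_add, ENNReal.coe_toNNReal ENNReal.ofReal_ne_top]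

/-- **The `L⁶` dichotomy**: for every `q ≥ 0`, `QuantBound 6 q ↔ q ≤ 2` — the uniform
`L^q_t L⁶_x` bound holds exactly on and below the energy line (`2/q + 3/6 = 3/2` at `q = 2`). -/
theorem quantBound_six_iff {q : ℝ} (hq0 : 0 ≤ q) : QuantBound 6 q ↔ q ≤ 2 :=
  ⟨fun h => le_of_not_gt fun h2 => not_quantBound_six h2 h, quantBound_six_of_le_two hq0⟩

/--
info: 'Summit.NavierStokesRegularity.NavierStokesRegularity.Theorems.L3TimeExponentPincerEnergyLineSixTop.quantBound_six_iff' depends on axioms: [propext,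
 Classical.choice,
 Quot.sound]
-/
#guard_msgs in
#print axioms quantBound_six_iff

/--
info: 'Summit.NavierStokesRegularity.NavierStokesRegularity.Theorems.L3TimeExponentPincerEnergyLineSixTop.not_quantBound_top' depends on axioms: [propext,
 Classical.choice,
 Quot.sound]
-/
#guard_msgs in
#print axioms not_quantBound_top

end Summit.NavierStokesRegularity.NavierStokesRegularity.Theorems.L3TimeExponentPincerEnergyLineSixTop

end
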